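import Mathlib.MeasureTheory.Integral.Bochner.Basic
import Mathlib.Analysis.SpecialFunctions.Exp
import HarnessLib

/-!
# `AlphaInputsT3ACAnnulusSmallFactor` — THE «a-DOOR» OF THE χ-CLASH DOCKET'S OWED FACT (★): the per-annulus-plaquette mass `a_p` of door 6
# (✓∕⧗`AlphaInputsT3ACAnnulusSplit.PkgCoreRows.log_gap_le_of_annulus`, binder `ha`) from TWO displayed letters — the SMALL-FACTOR letter `hsf` (fed by
# ✓`HistoryTailAlphaTopQuarterScaled.smallFactor_deterministic_loc_scaled`, [Balaban1985UV3] (71) at the scaled threshold) and the LOCAL-UNDAMPING letter `hund`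
# (B0-class, the same (58) Gaussian object as the bulk `b`, px8 g17 18:16:26Z) — in door 6 §4's integrand currency, record-free (cell ym3-torus, RECORD 17ds∕★★OWNER g38
# WORD №154 «GO a-door»; seat ym-ust-19936-w8 g17; helper `--supports stmt-QuantumFields-19936`)

THE POINT (made visible, as asked).  With `G = e^{−ℓ}·Gt` (`ℓ ≥ E` on the annulus `Ψ⁻¹A` — the localized action under the large plaquette, `Gt` = the integrand with that local
action removed) one has `∫ χ·𝟙[A](Ψ·)·G ≤ e^{−E}·∫ χ·Gt ≤ e^{−E}·Λund·b` (`a_door`), so door 6's correction term reads `(Σ_p a_p)∕b = |plaquettes|·e^{−E}·Λund`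
(`sum_a_door_div`): **the VALUE of the bulk `b` CANCELS — only `0 < b` and the ratio letter `hund` survive**, and `r_k = log(1 + |Λ_k|·e^{−(c²∕4)p(g_k)² + rem_k}·Λund)` is
superpolynomially small in `g_k` once `b₀² ≥ 4·max(B₃,1)²·(K′ + ν_L)` (`Λund ≤ (C_L∕g_k)^{ν_L}`, ✓`B10.smallFactor_le_pow`).  Pure measure theory; no (58) value, no row text, no
registry object.
HONEST SCOPE.  [folklore]; `hsf`, `hund` are HYPOTHESES; nothing of [Balaban1985UV3] is asserted; (★), #22∕#23, (O‴χₛ), `HistoryTailL` (19936), EX are NOT proved; def-free;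
count-neutral helper.  Rung R3 bookkeeping; not d = 4, not a mass gap, not Clay; the Yang–Mills mass gap is NOT proved.
References: T. Bałaban, Commun. Math. Phys. 102 (1985) 255–275 [Balaban1985UV3] ((11) p.258 «this small factor controls the part of the integral over a neighbourhood of the
plaquette», (67)–(71) p.273).
-/

set_option autoImplicit false

noncomputable section

namespace Summit.QuantumFields.YangMills.Theorems.AnnulusSmallFactor

open MeasureTheory

variable {β γ : Type*} [MeasurableSpace β] (μ : Measure β)

/-- **SMALL FACTOR OUT OF THE ANNULUS INTEGRAL.**  If the integrand factors as `G = e^{−ℓ}·Gt` with `Gt ≥ 0`, the weight `χ ≥ 0`, and the local exponent dominates a constant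
on the annulus, `E ≤ ℓ x` whenever `Ψ x ∈ A` (`hsf` — [Balaban1985UV3] (71) at the scaled threshold, ✓`smallFactor_deterministic_loc_scaled`), then
`∫ χ·𝟙[A](Ψ x)·G ≤ e^{−E}·∫ χ·Gt`. [cite: Balaban1985UV3, (71) p.273] -/
theorem integral_annulus_le_exp_mul (Ψ : β → γ) (A : Set γ)
    {χ G Gt ℓ : β → ℝ} (hχ : ∀ x, 0 ≤ χ x) (hGt : ∀ x, 0 ≤ Gt x) (hG : ∀ x, G x = Real.exp (-(ℓ x)) * Gt x)
    {E : ℝ} (hsf : ∀ x, Ψ x ∈ A → E ≤ ℓ x) (hint : Integrable (fun x => χ x * Gt x) μ) :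
    ∫ x, χ x * A.indicator (fun _ => (1 : ℝ)) (Ψ x) * G x ∂μ ≤ Real.exp (-E) * ∫ x, χ x * Gt x ∂μ := by
  rw [← integral_const_mul]
  refine integral_mono_of_nonneg (Filter.Eventually.of_forall fun x => ?_) (hint.const_mul _) (Filter.Eventually.of_forall fun x => ?_)
  · exact mul_nonneg (mul_nonneg (hχ x) (Set.indicator_nonneg (fun _ _ => zero_le_one) _))
      (by rw [hG x]; exact mul_nonneg (Real.exp_pos _).le (hGt x))
  · show χ x * A.indicator (fun _ => (1 : ℝ)) (Ψ x) * G x ≤ Real.exp (-E) * (χ x * Gt x)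
    by_cases hx : Ψ x ∈ A
    · rw [Set.indicator_of_mem hx, mul_one, hG x]
      have hexp : Real.exp (-(ℓ x)) ≤ Real.exp (-E) := Real.exp_le_exp.mpr (neg_le_neg (hsf x hx))
      calc χ x * (Real.exp (-(ℓ x)) * Gt x) = Real.exp (-(ℓ x)) * (χ x * Gt x) := by ring
        _ ≤ Real.exp (-E) * (χ x * Gt x) := mul_le_mul_of_nonneg_right hexp (mul_nonneg (hχ x) (hGt x))
    · rw [Set.indicator_of_notMem hx, mul_zero, zero_mul]
      exact mul_nonneg (Real.exp_pos _).le (mul_nonneg (hχ x) (hGt x))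

/-- **THE a-DOOR**: with the local-undamping letter `hund : ∫ χ·Gt ≤ Λund·b` (B0-class; the (58) integral with the action removed under the plaquette, against the bulk `b`),
the annulus mass is `≤ e^{−E}·Λund·b` — door 6's `a_p`. [cite: Balaban1985UV3, (11) p.258 and (71) p.273] -/
theorem a_door (Ψ : β → γ) (A : Set γ)
    {χ G Gt ℓ : β → ℝ} (hχ : ∀ x, 0 ≤ χ x) (hGt : ∀ x, 0 ≤ Gt x) (hG : ∀ x, G x = Real.exp (-(ℓ x)) * Gt x)
    {E : ℝ} (hsf : ∀ x, Ψ x ∈ A → E ≤ ℓ x) (hint : Integrable (fun x => χ x * Gt x) μ)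
    {Λund b : ℝ} (hund : ∫ x, χ x * Gt x ∂μ ≤ Λund * b) :
    ∫ x, χ x * A.indicator (fun _ => (1 : ℝ)) (Ψ x) * G x ∂μ ≤ Real.exp (-E) * Λund * b :=
  (integral_annulus_le_exp_mul μ Ψ A hχ hGt hG hsf hint).trans
    (by rw [mul_assoc]; exact mul_le_mul_of_nonneg_left hund (Real.exp_pos _).le)

/-- **THE BULK VALUE CANCELS**: feeding `a_p := e^{−E}·Λund·b` for every plaquette `p` of a finite index type into door 6's correction term gives
`(Σ_p a_p)∕b = |plaquettes|·e^{−E}·Λund` — independent of `b` (`b ≠ 0`). [folklore] -/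
theorem sum_a_door_div {ι : Type*} [Fintype ι] {E Λund b : ℝ} (hb : b ≠ 0) :
    (∑ _p : ι, Real.exp (-E) * Λund * b) / b = (Fintype.card ι : ℝ) * (Real.exp (-E) * Λund) := by
  rw [Finset.sum_const, Finset.card_univ, nsmul_eq_mul]
  field_simp

end Summit.QuantumFields.YangMills.Theorems.AnnulusSmallFactor

end
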